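import Summits.CriticalPhenomena.SAWScalingLimit.Theorems.SAWTotalPositivityBoundaryTP2Defs
import Summits.CriticalPhenomena.SAWScalingLimit.Theorems.SAWTotalPositivityBoundaryTP2Kernel
import Summits.CriticalPhenomena.SAWScalingLimit.Theorems.SAWTotalPositivityBoundaryTP2Symmetry
import Summits.CriticalPhenomena.SAWScalingLimit.Theorems.SAWTotalPositivityBoundaryTP2FirstStep
import Summits.CriticalPhenomena.SAWScalingLimit.Theorems.SAWTotalPositivityBoundaryTP2Avoid
import Summits.CriticalPhenomena.SAWScalingLimit.Theorems.SAWTotalPositivityBoundaryTP2SquareGadget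
import Summits.CriticalPhenomena.SAWScalingLimit.Theorems.EdgeOfPositivity.Negative.EdgeOfPositivityRectDomain
import HarnessLib

/-!
# Crux `BoundaryTP2` (stmt-CriticalPhenomena-7115), line `Sketch`: strip-3 transfer, single-column base

Tool stub `stub_strip3_base` of the line's skeleton (c6 three-row strip programme): the initial data
(`L = 0`) of the last-column transfer recursion on the strips `S_L = discreteDomainGraph (rectDomain L 2) 1`.
The single column `S_0` is the path graph `(0,0) ∼ (0,1) ∼ (0,2)` on `Site 2` (all other sites are
isolated), so for the fugacity-`x` self-avoiding path kernel (`x ≥ 0`, `r, s ∈ {0,1,2}`)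

* `Z_{S_0}((0,r),(0,s)) = x^{|r-s|}` (the unique self-avoiding path is the segment of the column);
* the disjoint-pair kernel `PP_0(r;s) = Σ x^{|γ|+|γ'|}` over the pairs `γ : (0,r) → (0,s)`,
  `γ' : (0,1) → (0,2-s)` with disjoint supports (`s ∈ {0,2}`) equals `x` if `r = s` (then `γ` is the
  trivial path at `(0,s)` and `γ'` runs in `S_0 - (0,s)`, where `(0,1)` is a leaf hanging on
  `(0,2-s)`: `γ'` is the single edge) and `0` if `r ≠ s` (then the start `(0,r)` of `γ` is an
  endpoint of `γ'`: it is `(0,1)` or `(0,2-s)`).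

Everything is first-step expansion at a leaf (`pathKernel_firstStep_single`), avoidance of a deleted
vertex (`stub_pathKernelOn_avoid`) and `Z(a,a) = 1` (`pathKernel_self`); the coordinate bookkeeping on
`Site 2 = Fin 2 → ℤ` closes with `omega` (adapted from `…BoundaryTP2LadderKernels`).
-/

noncomputable section

namespace Summit.CriticalPhenomena.SAWScalingLimit.Theorems.BoundaryTP2

open Literature.Probability.LatticeModels Literature.Probability.RandomPlanarGeometry
open Summit.CriticalPhenomena.SAWScalingLimit.Theorems.EdgeOfPositivity.Negative
open scoped ENNReal

/-! ## Coordinates on the single column -/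

/-- Adjacency in `ℤ²` in coordinates: the sites agree in one coordinate and differ by `1` in the
other. [folklore] -/
private theorem s3base_zd_adj_iff (u v : Site 2) :
    (zdGraph 2).Adj u v ↔
      ((v 0 = u 0 + 1 ∨ u 0 = v 0 + 1) ∧ v 1 = u 1) ∨
        ((v 1 = u 1 + 1 ∨ u 1 = v 1 + 1) ∧ v 0 = u 0) := by
  -- adapted from `ladder_zd_adj_iff` (…BoundaryTP2LadderKernels)
  rw [zdGraph_adj_iff, Fin.exists_fin_two]
  simp only [funext_iff, Fin.forall_fin_two, Pi.add_apply, Pi.single_eq_same,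
    Pi.single_eq_of_ne (one_ne_zero : (1 : Fin 2) ≠ 0),
    Pi.single_eq_of_ne (zero_ne_one : (0 : Fin 2) ≠ 1), add_zero]
  omega

/-- A site equals `st a b` iff its two coordinates are `a` and `b`. [folklore] -/
private theorem s3base_eq_st_iff (v : Site 2) (a b : ℤ) : v = st a b ↔ v 0 = a ∧ v 1 = b := by
  constructor
  · rintro rfl
    exact ⟨rfl, rfl⟩
  · rintro ⟨h0, h1⟩
    rw [← st_eta v, h0, h1]

/-- Adjacency of the single column `{0} × {0,1,2}` in coordinates. [folklore] -/
private theorem s3base_adj_iff (u v : Site 2) :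
    (discreteDomainGraph (rectDomain 0 2) 1).Adj u v ↔
      (((v 0 = u 0 + 1 ∨ u 0 = v 0 + 1) ∧ v 1 = u 1) ∨
          ((v 1 = u 1 + 1 ∨ u 1 = v 1 + 1) ∧ v 0 = u 0)) ∧
        ((0 ≤ u 0 ∧ u 0 ≤ 0) ∧ (0 ≤ u 1 ∧ u 1 ≤ 2)) ∧
          ((0 ≤ v 0 ∧ v 0 ≤ 0) ∧ (0 ≤ v 1 ∧ v 1 ≤ 2)) := by
  rw [adj_rect_iff, s3base_zd_adj_iff, mem_rectSites_iff, mem_rectSites_iff]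
  push_cast
  exact Iff.rfl

/-- In `S_0` the only neighbour of a corner `(0,c)` (`c ∈ {0,2}`) is the middle site `(0,1)`.
[folklore] -/
private theorem s3base_corner_neighborSet (c : ℤ) (hc : c = 0 ∨ c = 2) :
    (discreteDomainGraph (rectDomain 0 2) 1).neighborSet (st 0 c) = {st 0 1} := by
  ext v
  rw [SimpleGraph.mem_neighborSet, s3base_adj_iff, Set.mem_singleton_iff, s3base_eq_st_iff]
  simp only [st_zero, st_one]
  omega

/-- In `S_0 - (0,c)` (`c ∈ {0,2}`) the middle site `(0,1)` is a leaf hanging on the other corner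
`(0,2-c)`. [folklore] -/
private theorem s3base_hanging_neighborSet (c : ℤ) (hc : c = 0 ∨ c = 2) :
    ((discreteDomainGraph (rectDomain 0 2) 1).deleteEdges
        ((discreteDomainGraph (rectDomain 0 2) 1).incidenceSet (st 0 c))).neighborSet (st 0 1) =
      {st 0 (2 - c)} := by
  ext v
  rw [SimpleGraph.mem_neighborSet, deleteEdges_incidenceSet_adj, s3base_adj_iff,
    Set.mem_singleton_iff, Ne, Ne, s3base_eq_st_iff, s3base_eq_st_iff, s3base_eq_st_iff]
  simp only [st_zero, st_one]
  omega

/-! ## The kernels of the single column -/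

/-- `Z_{S_0}((0,c),(0,1)) = x` for a corner `c ∈ {0,2}`: the single edge. [folklore] -/
private theorem s3base_kernel_corner_mid {x : ℝ} (hx : 0 ≤ x) (c : ℤ) (hc : c = 0 ∨ c = 2) :
    pathKernel (discreteDomainGraph (rectDomain 0 2) 1) x (st 0 c) (st 0 1) = ENNReal.ofReal x := by
  have hab : st 0 c ≠ st 0 1 := by
    rw [Ne, s3base_eq_st_iff, st_zero, st_one]; omega
  rw [pathKernel_firstStep_single _ x hx hab (s3base_corner_neighborSet c hc), pathKernel_self,
    mul_one]

/-- `Z_{S_0}((0,c),(0,2-c)) = x²` for a corner `c ∈ {0,2}`: the whole column. [folklore] -/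
private theorem s3base_kernel_corner_corner {x : ℝ} (hx : 0 ≤ x) (c : ℤ) (hc : c = 0 ∨ c = 2) :
    pathKernel (discreteDomainGraph (rectDomain 0 2) 1) x (st 0 c) (st 0 (2 - c)) =
      ENNReal.ofReal (x ^ 2) := by
  have hab : st 0 c ≠ st 0 (2 - c) := by
    rw [Ne, s3base_eq_st_iff, st_zero, st_one]; omega
  have h1 : st 0 1 ≠ st 0 (2 - c) := by
    rw [Ne, s3base_eq_st_iff, st_zero, st_one]; omega
  rw [pathKernel_firstStep_single _ x hx hab (s3base_corner_neighborSet c hc),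
    pathKernel_firstStep_single _ x hx h1 (s3base_hanging_neighborSet c hc), pathKernel_self,
    mul_one, ← ENNReal.ofReal_mul hx, ← pow_two]

/-- In `S_0`, the paths `(0,1) → (0,2-s)` avoiding the corner `(0,s)` (`s ∈ {0,2}`) weigh `x`: they
are the paths of `S_0 - (0,s)`, where `(0,1)` is a leaf hanging on `(0,2-s)`. [folklore] -/
private theorem s3base_kernelOn_avoid_corner {x : ℝ} (hx : 0 ≤ x) (s : ℤ) (hs : s = 0 ∨ s = 2) :
    pathKernelOn (discreteDomainGraph (rectDomain 0 2) 1) x (st 0 1) (st 0 (2 - s))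
        {γ | st 0 s ∉ γ.1.support} = ENNReal.ofReal x := by
  have h1s : st 0 1 ≠ st 0 s := by
    rw [Ne, s3base_eq_st_iff, st_zero, st_one]; omega
  have h2s : st 0 (2 - s) ≠ st 0 s := by
    rw [Ne, s3base_eq_st_iff, st_zero, st_one]; omega
  have h12 : st 0 1 ≠ st 0 (2 - s) := by
    rw [Ne, s3base_eq_st_iff, st_zero, st_one]; omega
  rw [stub_pathKernelOn_avoid _ x _ _ _ h1s h2s,
    pathKernel_firstStep_single _ x hx h12 (s3base_hanging_neighborSet s hs), pathKernel_self,
    mul_one]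

/-! ## The stub -/

open Classical in
/-- **Tool stub `stub_strip3_base`.** The single column `S_0` (the path graph
`(0,0) ∼ (0,1) ∼ (0,2)`): `Z_0((0,r),(0,s)) = x^{|r-s|}`, and the disjoint-pair kernels
`PP_0(r;s) = x` if `r = s` (empty path at `(0,s)`, the edge `(0,1)(0,2-s)`), `0` otherwise (the start
`(0,r)` of the path `(0,r) → (0,s)` is an endpoint of every path `(0,1) → (0,2-s)`). [folklore] -/
theorem stub_strip3_base {x : ℝ} (hx : 0 ≤ x) (r : ℤ) (hr : 0 ≤ r ∧ r ≤ 2) :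
    (∀ s : ℤ, 0 ≤ s ∧ s ≤ 2 →
      pathKernel (discreteDomainGraph (rectDomain 0 2) 1) x (st 0 r) (st 0 s) =
        ENNReal.ofReal (x ^ (r - s).natAbs)) ∧
    (∀ s : ℤ, s = 0 ∨ s = 2 →
      (∑' (γ : (discreteDomainGraph (rectDomain 0 2) 1).Path (st 0 r) (st 0 s))
          (γ' : (discreteDomainGraph (rectDomain 0 2) 1).Path (st 0 1) (st 0 (2 - s))),
        (if List.Disjoint γ.1.support γ'.1.support then
          ENNReal.ofReal (x ^ γ.1.length) * ENNReal.ofReal (x ^ γ'.1.length) else 0)) =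
        if r = s then ENNReal.ofReal x else 0) := by
  refine ⟨fun s hs => ?_, fun s hs => ?_⟩
  · -- the kernels `x^{|r-s|}`
    rcases eq_or_ne r s with rfl | hrs
    · rw [pathKernel_self, sub_self, Int.natAbs_zero, pow_zero, ENNReal.ofReal_one]
    by_cases hr1 : r = 1
    · subst hr1
      rw [pathKernel_comm, s3base_kernel_corner_mid hx s (by omega),
        show ((1 : ℤ) - s).natAbs = 1 by omega, pow_one]
    by_cases hs1 : s = 1
    · subst hs1
      rw [s3base_kernel_corner_mid hx r (by omega), show (r - 1).natAbs = 1 by omega, pow_one]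
    obtain rfl : s = 2 - r := by omega
    rw [s3base_kernel_corner_corner hx r (by omega), show (r - (2 - r)).natAbs = 2 by omega]
  · -- the disjoint-pair kernels
    rcases eq_or_ne r s with rfl | hrs
    · -- `r = s`: `γ` is the trivial path at `(0,s)`, `γ'` avoids `(0,s)`
      rw [if_pos rfl]
      have huniq : ∀ γ : (discreteDomainGraph (rectDomain 0 2) 1).Path (st 0 r) (st 0 r),
          γ = ⟨SimpleGraph.Walk.nil, SimpleGraph.Walk.IsPath.nil⟩ := by
        -- adapted from `pathKernel_self` (…BoundaryTP2Symmetry)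
        rintro ⟨p, hp⟩
        ext
        exact SimpleGraph.Walk.eq_nil_iff_nil.2 (SimpleGraph.Walk.isPath_iff_nil.1 hp)
      rw [tsum_eq_single
        (⟨SimpleGraph.Walk.nil, SimpleGraph.Walk.IsPath.nil⟩ :
          (discreteDomainGraph (rectDomain 0 2) 1).Path (st 0 r) (st 0 r))
        (fun γ hγ => absurd (huniq γ) hγ)]
      rw [← s3base_kernelOn_avoid_corner hx r hs]
      unfold pathKernelOn
      refine tsum_congr fun γ' => ?_
      simp only [SimpleGraph.Walk.support_nil, SimpleGraph.Walk.length_nil, pow_zero,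
        ENNReal.ofReal_one, one_mul]
      split_ifs with h
      · rw [List.singleton_disjoint] at h
        symm
        apply Set.indicator_of_mem
        exact h
      · rw [List.singleton_disjoint] at h
        symm
        apply Set.indicator_of_notMem
        exact h
    · -- `r ≠ s`: the start `(0,r)` of `γ` lies on every `γ'`
      rw [if_neg hrs, ENNReal.tsum_eq_zero]
      intro γ
      rw [ENNReal.tsum_eq_zero]
      intro γ'
      have hmem : st 0 r ∈ γ'.1.support := by
        rcases (show r = 1 ∨ r = 2 - s by omega) with rfl | rfl
        · exact γ'.1.start_mem_support
        · exact γ'.1.end_mem_support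
      exact if_neg fun hdisj => hdisj γ.1.start_mem_support hmem
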